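import Mathlib

/-!
# Route `FilamentSkeletonRss` · crux `SelectionBoxRJ` (stmt-NavierStokesRegularity-21220) — rung tools:
# Poincaré bounds for ball-supported test fields and injectivity of the model clause-13 operator on a short window

Lane `ns-filament-19175-p1` (g6); the clause-13-J leg of the memo `SIGMA-SCALING-21220.md` (item evidence #18, §0 (3),
§5).  Helper file `--supports stmt-NavierStokesRegularity-21220`; Mathlib only.

Clause 13-J of `SelectionBoxRJ` / `TransverseReductionRJ` asks for a weighted injectivity estimate
`‖Y_j‖ ≤ cnd · L` of the linearised normal-tangency map on `C²` normal test families SUPPORTED IN THE TANGENCY BALL.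
In the σ-units of the memo the in-ball arc is the FIXED interval `|σ| ≤ ℓ = Rb√(8π/γ)` and the linearised operator is,
at leading order, `L Y = J Y″ + P(σ) Y′ + Q(σ) Y` with `J` an isometry (rotation by a right angle in the normal
plane), `‖P‖ ≤ W` (the slip `w̃`), `‖Q‖ ≤ K` (strain).  The why-might-fail «near-kernel of −wY′ + A_N Y on long
arcs» is thus a question on a fixed short window, where the second-order term dominates:

* `supported_deriv_eq_zero`, `supported_bounds` — a `C²` field vanishing for `|σ| ≥ ℓ` has `Y′(−ℓ) = 0` and obeys the
  Poincaré bounds `‖Y′ σ‖ ≤ 2ℓ B`, `‖Y σ‖ ≤ 4ℓ² B` on `[−ℓ, ℓ]` whenever `‖Y″‖ ≤ B` there.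
* `model_clause13_injective` — if `‖J z‖ = ‖z‖`, `‖P σ‖ ≤ W`, `‖Q σ‖ ≤ K` on `[−ℓ, ℓ]`, `2ℓW + 4ℓ²K ≤ ½`, and
  `‖L Y σ‖ ≤ ε` on `[−ℓ, ℓ]`, then `‖Y″ σ‖ ≤ 2ε`, `‖Y′ σ‖ ≤ 4ℓε` and `‖Y σ‖ ≤ 8ℓ²ε` on `[−ℓ, ℓ]`: the model operator
  is injective on ball-supported fields with constant `cnd = 8ℓ²`, uniformly in `Γ` (which does not appear), for every
  window short enough that `2ℓW + 4ℓ²K ≤ ½` — i.e. for small `Rb`.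

HONEST FRAMING.  Model-level (leading order in σ-units, unweighted norms) bookkeeping for the rung ladder of a
HYPOTHETICAL filament box; not clause 13-J itself; nothing here is a claim about Navier–Stokes regularity or blow-up.
-/

set_option linter.dupNamespace false

noncomputable section

namespace Summit.NavierStokesRegularity.NavierStokesRegularity.Theorems

open Set Filter
open scoped Topology

namespace SelectionBoxRJRung

variable {E : Type*} [NormedAddCommGroup E] [NormedSpace ℝ E]

/-- A `C¹` function vanishing on `[ℓ, ∞)`... here: a differentiable `Y` with `Y σ = 0` for `ℓ ≤ |σ|` has
`Y′(−ℓ) = 0` and `Y′(ℓ) = 0` when `Y′` is continuous (`0 < ℓ`): the derivative vanishes on the open exterior and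
extends by continuity. [folklore] -/
theorem supported_deriv_eq_zero {Y : ℝ → E} {ℓ : ℝ} (hℓ : 0 < ℓ) (hY : ContDiff ℝ 1 Y)
    (hsupp : ∀ σ, ℓ ≤ |σ| → Y σ = 0) : deriv Y (-ℓ) = 0 ∧ deriv Y ℓ = 0 := by
  have hcont : Continuous (deriv Y) := hY.continuous_deriv le_rfl
  -- `deriv Y = 0` on the open sets `(-∞, -ℓ)` and `(ℓ, ∞)`
  have hleft : ∀ σ, σ < -ℓ → deriv Y σ = 0 := by
    intro σ hσ
    have hev : Y =ᶠ[𝓝 σ] fun _ => (0 : E) := by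
      filter_upwards [Iio_mem_nhds hσ] with τ hτ
      have hτ' : τ < -ℓ := hτ
      exact hsupp τ (by rw [abs_of_neg (by linarith)]; linarith)
    rw [Filter.EventuallyEq.deriv_eq hev, deriv_const]
  have hright : ∀ σ, ℓ < σ → deriv Y σ = 0 := by
    intro σ hσ
    have hev : Y =ᶠ[𝓝 σ] fun _ => (0 : E) := by
      filter_upwards [Ioi_mem_nhds hσ] with τ hτ
      have hτ' : ℓ < τ := hτ
      exact hsupp τ (by rw [abs_of_pos (by linarith)]; exact hτ'.le)
    rw [Filter.EventuallyEq.deriv_eq hev, deriv_const]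
  constructor
  · -- limit from the left at `-ℓ`
    have h1 : Tendsto (deriv Y) (𝓝[<] (-ℓ)) (𝓝 (deriv Y (-ℓ))) := (hcont.tendsto _).mono_left nhdsWithin_le_nhds
    have h2 : Tendsto (deriv Y) (𝓝[<] (-ℓ)) (𝓝 0) := by
      apply tendsto_const_nhds.congr'
      filter_upwards [self_mem_nhdsWithin] with τ hτ
      exact (hleft τ hτ).symm
    exact tendsto_nhds_unique h1 h2
  · have h1 : Tendsto (deriv Y) (𝓝[>] ℓ) (𝓝 (deriv Y ℓ)) := (hcont.tendsto _).mono_left nhdsWithin_le_nhds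
    have h2 : Tendsto (deriv Y) (𝓝[>] ℓ) (𝓝 0) := by
      apply tendsto_const_nhds.congr'
      filter_upwards [self_mem_nhdsWithin] with τ hτ
      exact (hright τ hτ).symm
    exact tendsto_nhds_unique h1 h2

/-- **Poincaré bounds for ball-supported `C²` fields.** If `Y` is `C²`, vanishes for `|σ| ≥ ℓ` (`ℓ > 0`) and
`‖Y″ σ‖ ≤ B` on `[−ℓ, ℓ]`, then on `[−ℓ, ℓ]`: `‖Y′ σ‖ ≤ 2ℓB` and `‖Y σ‖ ≤ 4ℓ²B` (mean value inequality from
the left endpoint, where `Y = Y′ = 0`). [folklore] -/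
theorem supported_bounds {Y : ℝ → E} {ℓ B : ℝ} (hℓ : 0 < ℓ) (hY : ContDiff ℝ 2 Y)
    (hsupp : ∀ σ, ℓ ≤ |σ| → Y σ = 0) (hB : ∀ σ ∈ Icc (-ℓ) ℓ, ‖deriv (deriv Y) σ‖ ≤ B) :
    ∀ σ ∈ Icc (-ℓ) ℓ, ‖deriv Y σ‖ ≤ 2 * ℓ * B ∧ ‖Y σ‖ ≤ 4 * ℓ ^ 2 * B := by
  have hYd : Differentiable ℝ Y := hY.differentiable (by norm_num)
  have hTd : Differentiable ℝ (deriv Y) := hY.differentiable_deriv_two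
  have hB0 : 0 ≤ B := (norm_nonneg _).trans (hB (-ℓ) ⟨le_rfl, by linarith⟩)
  obtain ⟨hdl, -⟩ := supported_deriv_eq_zero hℓ (hY.of_le (by norm_num)) hsupp
  have hYl : Y (-ℓ) = 0 := hsupp (-ℓ) (by rw [abs_neg, abs_of_pos hℓ])
  -- first derivative
  have hD : ∀ σ ∈ Icc (-ℓ) ℓ, ‖deriv Y σ‖ ≤ 2 * ℓ * B := by
    intro σ hσ
    have h := Convex.norm_image_sub_le_of_norm_deriv_le (f := deriv Y) (fun τ _ => hTd τ) hB
      (convex_Icc (-ℓ) ℓ) ⟨le_rfl, by linarith⟩ hσ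
    rw [hdl, sub_zero] at h
    calc ‖deriv Y σ‖ ≤ B * ‖σ - -ℓ‖ := h
      _ ≤ B * (2 * ℓ) := by
          refine mul_le_mul_of_nonneg_left ?_ hB0
          rw [Real.norm_eq_abs, abs_le]; constructor <;> linarith [hσ.1, hσ.2]
      _ = 2 * ℓ * B := by ring
  intro σ hσ
  refine ⟨hD σ hσ, ?_⟩
  have h := Convex.norm_image_sub_le_of_norm_deriv_le (f := Y) (fun τ _ => hYd τ) hD
    (convex_Icc (-ℓ) ℓ) ⟨le_rfl, by linarith⟩ hσ
  rw [hYl, sub_zero] at h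
  calc ‖Y σ‖ ≤ 2 * ℓ * B * ‖σ - -ℓ‖ := h
    _ ≤ 2 * ℓ * B * (2 * ℓ) := by
        refine mul_le_mul_of_nonneg_left ?_ (by positivity)
        rw [Real.norm_eq_abs, abs_le]; constructor <;> linarith [hσ.1, hσ.2]
    _ = 4 * ℓ ^ 2 * B := by ring

/-- **Injectivity of the model clause-13 operator on a short window.** Let `Y` be `C²` and vanish for `|σ| ≥ ℓ`
(`ℓ > 0`); let `J : E →L[ℝ] E` be norm-preserving and `P Q : ℝ → (E →L[ℝ] E)` with `‖P σ‖ ≤ W`, `‖Q σ‖ ≤ K` on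
`[−ℓ, ℓ]`, where `2ℓW + 4ℓ²K ≤ ½`.  If the model residual `J (Y″ σ) + P σ (Y′ σ) + Q σ (Y σ)` has norm `≤ ε` on
`[−ℓ, ℓ]`, then on `[−ℓ, ℓ]`: `‖Y″ σ‖ ≤ 2ε`, `‖Y′ σ‖ ≤ 4ℓε`, `‖Y σ‖ ≤ 8ℓ²ε`. [folklore] -/
theorem model_clause13_injective {Y : ℝ → E} {ℓ W K ε : ℝ} (hℓ : 0 < ℓ) (hY : ContDiff ℝ 2 Y)
    (hsupp : ∀ σ, ℓ ≤ |σ| → Y σ = 0) (J : E →L[ℝ] E) (hJ : ∀ z, ‖J z‖ = ‖z‖)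
    (P Q : ℝ → (E →L[ℝ] E)) (hW : 0 ≤ W) (hK : 0 ≤ K) (hP : ∀ σ ∈ Icc (-ℓ) ℓ, ‖P σ‖ ≤ W)
    (hQ : ∀ σ ∈ Icc (-ℓ) ℓ, ‖Q σ‖ ≤ K) (hsmall : 2 * ℓ * W + 4 * ℓ ^ 2 * K ≤ 1 / 2)
    (hres : ∀ σ ∈ Icc (-ℓ) ℓ, ‖J (deriv (deriv Y) σ) + P σ (deriv Y σ) + Q σ (Y σ)‖ ≤ ε) :
    ∀ σ ∈ Icc (-ℓ) ℓ, ‖deriv (deriv Y) σ‖ ≤ 2 * ε ∧ ‖deriv Y σ‖ ≤ 4 * ℓ * ε ∧ ‖Y σ‖ ≤ 8 * ℓ ^ 2 * ε := by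
  have hcont2 : Continuous (deriv (deriv Y)) := by
    have h := hY.continuous_iteratedDeriv 2 le_rfl
    rwa [iteratedDeriv_succ, iteratedDeriv_one] at h
  -- the maximum of `‖Y″‖` on the compact window
  have hne : (Icc (-ℓ) ℓ).Nonempty := ⟨0, ⟨by linarith, hℓ.le⟩⟩
  obtain ⟨s₀, hs₀, hmax⟩ := (isCompact_Icc (a := -ℓ) (b := ℓ)).exists_isMaxOn hne
    (hcont2.norm.continuousOn)
  set B : ℝ := ‖deriv (deriv Y) s₀‖ with hBdef
  have hB : ∀ σ ∈ Icc (-ℓ) ℓ, ‖deriv (deriv Y) σ‖ ≤ B := fun σ hσ => hmax hσ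
  have hbd := supported_bounds hℓ hY hsupp hB
  have hε0 : 0 ≤ ε := (norm_nonneg _).trans (hres s₀ hs₀)
  -- `B ≤ ε + (2ℓW + 4ℓ²K) B`
  have hkey : B ≤ ε + (2 * ℓ * W + 4 * ℓ ^ 2 * K) * B := by
    obtain ⟨h1, h2⟩ := hbd s₀ hs₀
    have hB0 : 0 ≤ B := norm_nonneg _
    have hJ' : ‖J (deriv (deriv Y) s₀)‖ = B := hJ _
    have htri : ‖J (deriv (deriv Y) s₀)‖ ≤
        ‖J (deriv (deriv Y) s₀) + P s₀ (deriv Y s₀) + Q s₀ (Y s₀)‖ + ‖P s₀ (deriv Y s₀)‖ + ‖Q s₀ (Y s₀)‖ := by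
      have e1 : J (deriv (deriv Y) s₀) = (J (deriv (deriv Y) s₀) + P s₀ (deriv Y s₀) + Q s₀ (Y s₀)) -
          P s₀ (deriv Y s₀) - Q s₀ (Y s₀) := by abel
      calc ‖J (deriv (deriv Y) s₀)‖ = ‖(J (deriv (deriv Y) s₀) + P s₀ (deriv Y s₀) + Q s₀ (Y s₀)) -
            P s₀ (deriv Y s₀) - Q s₀ (Y s₀)‖ := by rw [← e1]
        _ ≤ ‖(J (deriv (deriv Y) s₀) + P s₀ (deriv Y s₀) + Q s₀ (Y s₀)) - P s₀ (deriv Y s₀)‖ + ‖Q s₀ (Y s₀)‖ :=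
            norm_sub_le _ _
        _ ≤ ‖J (deriv (deriv Y) s₀) + P s₀ (deriv Y s₀) + Q s₀ (Y s₀)‖ + ‖P s₀ (deriv Y s₀)‖ + ‖Q s₀ (Y s₀)‖ := by
            linarith [norm_sub_le (J (deriv (deriv Y) s₀) + P s₀ (deriv Y s₀) + Q s₀ (Y s₀)) (P s₀ (deriv Y s₀))]
    have hPb : ‖P s₀ (deriv Y s₀)‖ ≤ W * (2 * ℓ * B) :=
      (ContinuousLinearMap.le_opNorm _ _).trans (mul_le_mul (hP s₀ hs₀) h1 (norm_nonneg _) hW)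
    have hQb : ‖Q s₀ (Y s₀)‖ ≤ K * (4 * ℓ ^ 2 * B) :=
      (ContinuousLinearMap.le_opNorm _ _).trans (mul_le_mul (hQ s₀ hs₀) h2 (norm_nonneg _) hK)
    have := hres s₀ hs₀
    nlinarith [htri, hPb, hQb, hJ']
  have hB2 : B ≤ 2 * ε := by
    have hB0 : 0 ≤ B := norm_nonneg _
    nlinarith [hkey, hsmall, mul_le_mul_of_nonneg_right hsmall hB0]
  intro σ hσ
  obtain ⟨h1, h2⟩ := hbd σ hσ
  refine ⟨(hB σ hσ).trans hB2, ?_, ?_⟩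
  · calc ‖deriv Y σ‖ ≤ 2 * ℓ * B := h1
      _ ≤ 2 * ℓ * (2 * ε) := mul_le_mul_of_nonneg_left hB2 (by positivity)
      _ = 4 * ℓ * ε := by ring
  · calc ‖Y σ‖ ≤ 4 * ℓ ^ 2 * B := h2
      _ ≤ 4 * ℓ ^ 2 * (2 * ε) := mul_le_mul_of_nonneg_left hB2 (by positivity)
      _ = 8 * ℓ ^ 2 * ε := by ring

end SelectionBoxRJRung

end Summit.NavierStokesRegularity.NavierStokesRegularity.Theorems
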